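import Summits.QuantumFields.YangMills.Theorems.LuscherReductionTwistedTraceScalingZPEBounds
import Summits.QuantumFields.YangMills.Theorems.LuscherReductionTwistedTraceScalingStiffTrialMeasurable
import HarnessLib

/-!
# `zpeSum` is CONTINUOUS in the configuration; its sub-level sets are closed, measurable, gauge and twist invariant
# (lane A of S-BASE, crux `TwistedTraceScaling` stmt-QuantumFields-20203; a brick for the k = 0 FLOOR of the BO sub-target, design note
# `pub/ym-fleet/ym-luscher-20007-p1/COARSE-DESIGN.md` §17.8)

The floor region of C3d is cut out by `zpeSum L κ U ≤ 6·toronZPE κ 0 0 + ε·δ(β)` (plus action/gain conditions); for the Rayleigh door one needs this set to be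
measurable and invariant.  Here:
* ★ `continuous_zpeSum` — `U ↦ zpeSum L κ U` is continuous (`κ ≥ 0`): kinetic steps `W = U'·U⁻¹ → 1` move the covariant curl by `≤ 504τ√N` in operator norm
  (lane B's `norm_covCurl_step_sub_le`) and the zero-point sum is globally Lipschitz in the curl (`abs_zpeSum_sub_le`, Weyl–Mirsky);
* `measurable_zpeSum`, `isClosed_zpeSum_le`, `measurableSet_zpeSum_le`;
* `zpeSum_twist3` — twist invariance (`covCurl_twist3`); with `zpeSum_gaugeTransform` (`…ZPEBounds`) the sub-level sets are gauge and twist invariant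
  (`gaugeTransform_mem_zpeSumLe_iff`, `twist3_mem_zpeSumLe_iff`).
HONEST FRAMING: bookkeeping for a stub lane of a child of the CONDITIONAL reduction route (femto rung R2b1); not infinite volume, not a gap, not Clay.
-/

set_option autoImplicit false

noncomputable section

open MeasureTheory Real Filter Topology
open scoped BigOperators
open Literature.MathematicalPhysics.QuantumFieldTheory
open Literature.MathematicalPhysics.QuantumLattice

namespace Summit.QuantumFields.YangMills.Theorems.FemtoTransferGap

open TwoLattice TwoLattice.Toron TwoLattice.Cov TwoLattice.Stiff

variable {L : ℕ} [NeZero L]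

/-! ## §1 Continuity -/

/-- ★ **`zpeSum` is continuous in `U`** (`κ ≥ 0`). [cite: HornJohnson2013, Cor 7.3.5] [cite: Luscher1983, §3] -/
theorem continuous_zpeSum {κ : ℝ} (hκ : 0 ≤ κ) : Continuous fun U : GaugeConfig 3 L SU2 => zpeSum L κ U := by
  refine continuous_iff_continuousAt.2 fun U => ?_
  rw [ContinuousAt, Metric.tendsto_nhds]
  intro ε hε
  -- Lipschitz constant of the zero-point sum along kinetic steps
  set A : ℝ := ((Fintype.card (Edge 3 L) * 3 : ℕ) : ℝ) * (Real.sqrt (κ / 2) * (504 * Real.sqrt (Fintype.card (Plaquette 3 L × Fin 3)))) with hA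
  have hA0 : 0 ≤ A := by positivity
  set τ : ℝ := min 1 (ε / (2 * (A + 1))) with hτ
  have hτ0 : 0 < τ := lt_min one_pos (by positivity)
  have hτ1 : τ ≤ 1 := min_le_left _ _
  have hτε : A * τ < ε := by
    have h1 : τ ≤ ε / (2 * (A + 1)) := min_le_right _ _
    have h2 : A * τ ≤ A * (ε / (2 * (A + 1))) := mul_le_mul_of_nonneg_left h1 hA0
    have h3 : A * (ε / (2 * (A + 1))) < ε := by
      rw [mul_div_assoc']
      rw [div_lt_iff₀ (by positivity)]
      nlinarith
    linarith
  -- the kinetic step `W = U'·U⁻¹` is small near `U`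
  have hcont : ∀ (e : Edge 3 L) (c : Fin 3), ContinuousAt (fun U' : GaugeConfig 3 L SU2 => |vecPart (U' e * (U e)⁻¹) c|) U := fun e c => by
    refine Continuous.continuousAt ?_
    refine (continuous_abs.comp ((continuous_apply c).comp (continuous_vecPart.comp ?_)))
    exact ((continuous_apply e).mul continuous_const)
  have hev : ∀ (e : Edge 3 L) (c : Fin 3), ∀ᶠ U' in 𝓝 U, |vecPart (U' e * (U e)⁻¹) c| < τ := fun e c => by
    have h1 : vecPart (1 : SU2) = 0 := by ext a; fin_cases a <;> simp
    have h0 : (fun U' : GaugeConfig 3 L SU2 => |vecPart (U' e * (U e)⁻¹) c|) U < τ := by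
      simp only [mul_inv_cancel, h1, Pi.zero_apply, abs_zero]; exact hτ0
    exact (hcont e c).eventually_lt_const h0
  have hall : ∀ᶠ U' in 𝓝 U, ∀ e : Edge 3 L, ∀ c : Fin 3, |vecPart (U' e * (U e)⁻¹) c| < τ := by
    simp only [eventually_all]
    exact hev
  refine hall.mono fun U' hU' => ?_
  -- `U' = W·U` with `|vecPart W| ≤ τ`
  set W : GaugeConfig 3 L SU2 := fun e => U' e * (U e)⁻¹ with hW
  have hWU : W * U = U' := by funext e; simp [hW]
  have hw : ∀ (e : Edge 3 L) (c : Fin 3), |vecPart (W e) c| ≤ τ := fun e c => (hU' e c).le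
  have hstep := abs_zpeSum_sub_le (W * U) U hκ (by positivity : (0 : ℝ) ≤ 504 * τ * Real.sqrt (Fintype.card (Plaquette 3 L × Fin 3)))
    fun v => norm_covCurl_step_sub_le U hτ1 hw v
  rw [hWU] at hstep
  rw [Real.dist_eq]
  calc |zpeSum L κ U' - zpeSum L κ U| ≤ ((Fintype.card (Edge 3 L) * 3 : ℕ) : ℝ) * (Real.sqrt (κ / 2) * (504 * τ * Real.sqrt (Fintype.card (Plaquette 3 L × Fin 3)))) := hstep
    _ = A * τ := by rw [hA]; ring
    _ < ε := hτε

/-- `zpeSum` is measurable in `U`. [folklore] -/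
theorem measurable_zpeSum {κ : ℝ} (hκ : 0 ≤ κ) : Measurable fun U : GaugeConfig 3 L SU2 => zpeSum L κ U := by
  haveI : SecondCountableTopology SU2 := secondCountableTopology_su2
  exact (continuous_zpeSum hκ).measurable

/-- The sub-level set `{zpeSum ≤ c}` is closed. [folklore] -/
theorem isClosed_zpeSum_le {κ : ℝ} (hκ : 0 ≤ κ) (c : ℝ) : IsClosed {U : GaugeConfig 3 L SU2 | zpeSum L κ U ≤ c} :=
  isClosed_le (continuous_zpeSum hκ) continuous_const

/-- The sub-level set `{zpeSum ≤ c}` is measurable. [folklore] -/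
theorem measurableSet_zpeSum_le {κ : ℝ} (hκ : 0 ≤ κ) (c : ℝ) : MeasurableSet {U : GaugeConfig 3 L SU2 | zpeSum L κ U ≤ c} :=
  measurableSet_le (measurable_zpeSum hκ) measurable_const

/-! ## §2 Invariance of the sub-level sets -/

/-- Twist invariance of `zpeSum`. [cite: tHooft1979] -/
theorem zpeSum_twist3 (z : Fin 3 → Bool) (U : GaugeConfig 3 L SU2) (κ : ℝ) : zpeSum L κ (TT.twist3 z U) = zpeSum L κ U := by
  unfold zpeSum; rw [covCurl_twist3]

/-- The sub-level sets of `zpeSum` are gauge invariant. [cite: Luscher1983, §3] -/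
theorem gaugeTransform_mem_zpeSumLe_iff (g : Site 3 L → SU2) (U : GaugeConfig 3 L SU2) (κ c : ℝ) :
    gaugeTransform g U ∈ {U : GaugeConfig 3 L SU2 | zpeSum L κ U ≤ c} ↔ U ∈ {U : GaugeConfig 3 L SU2 | zpeSum L κ U ≤ c} := by
  simp only [Set.mem_setOf_eq, zpeSum_gaugeTransform]

/-- The sub-level sets of `zpeSum` are twist invariant. [cite: tHooft1979] -/
theorem twist3_mem_zpeSumLe_iff (z : Fin 3 → Bool) (U : GaugeConfig 3 L SU2) (κ c : ℝ) :
    TT.twist3 z U ∈ {U : GaugeConfig 3 L SU2 | zpeSum L κ U ≤ c} ↔ U ∈ {U : GaugeConfig 3 L SU2 | zpeSum L κ U ≤ c} := by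
  simp only [Set.mem_setOf_eq, zpeSum_twist3]

end Summit.QuantumFields.YangMills.Theorems.FemtoTransferGap

end
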